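import Summits.ABC.ABC.Theses.IsogenyGlueCongruence
import Summits.ABC.ABC.Theorems.IsogenyGlueCongruenceDegreePrimeCongruence
import Summits.ABC.ABC.Theorems.DefiniteXiFreyModularityCDT
import Literature.NumberTheory.Automorphic.BCDTModularity
import Literature.NumberTheory.EllipticCurves.PeriodRelationsProofs
import Literature.NumberTheory.EllipticCurves.PastenSpectralDegreeIsogenyBoundProofs
import Literature.NumberTheory.EllipticCurves.ModularCurveNeronLatticeProofs
import Literature.NumberTheory.EllipticCurves.ModularParametrizationDegreeHoldsProofs
import HarnessLib

/-!
# Route IsogenyGlueCongruence, item `DegreePrimeCongruence` (stmt-ABC-14828): the route decl from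
# two named facts, and its equivalence with semistable modularity

`Summits/ABC/ABC/Theorems/IsogenyGlueCongruenceDegreePrimeCongruence.lean` proves the item's
signature from three named facts (`degreePrimeCongruence_of_facts`). Since then

* the route decl `Summit.ABC.ABC.Theses.IsogenyGlueCongruence.DegreePrimeCongruence` has been
  materialised in the route file (rev 9–10), and
* Pasten's Thm. 5.5 `δ_{1,N} ∣ ∏_{P ≠ 𝕀_f} η_f(P)` has become a THEOREM of the tree
  (`PastenShimura2024_thm_5_5_holds`, `PeriodRelationsProofs.lean`: Riemann's period relations for
  `X₀(N)` in Petersson form).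

This file records the consequences, concluding in the route decl BY NAME:

* `degreePrimeCongruence_of_datum` — **per curve, unconditionally in modularity**: a globally
  minimal elliptic `W/ℚ` that admits SOME parametrisation datum at level `N` admits one, `D'`, all of
  whose degree primes `ℓ` are `≤ 163` or congruence primes of `f_W` with another newform `g` of level
  `M ∣ N` in the residue-field shape of the item; the only hypothesis left is the Mazur–Kenku
  comparison `PastenShimura2024_minimalDegree_le_163_mul` (Pasten 2024, §3 p. 13).
* `degreePrimeCongruence_iff_semistableModularity` — **given that comparison, the item is
  EQUIVALENT to the modularity of semistable elliptic curves over `ℚ`** (`BCDT.IsModular W` for every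
  semistable `W`, Wiles 1995 Thm. 0.4 with Taylor–Wiles 1995): (→) the datum carries the newform;
  (←) a newform gives a datum (`nonempty_modularParametrizationData_of_isNewformOf` with the
  theorems `exists_isNeronLatticeOf_holds`, `IsNewformOf.exists_maninConstant_ne_zero_holds`), then
  `degreePrimeCongruence_of_datum`. So the item's content beyond Mazur–Kenku is exactly Wiles'
  theorem, and its signature cannot be closed before `exists_isNewformOf` (semistable case) is.
* `degreePrimeCongruence_of_modularity` — the route decl from the two named facts
  `exists_isNewformOf` (BCDT 2001, Thm. A; only the semistable case is used) and
  `PastenShimura2024_minimalDegree_le_163_mul`.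
* `degreePrimeCongruence_of_mazurKenku` — the same with the second fact replaced by its two printed
  ingredients via the tree's `PastenShimura2024_minimalDegree_le_163_mul_of_mazurKenku`: the
  Mazur–Kenku named fact `mazurKenku_exists_cyclic_isogeny` (Mazur 1978, Thm. 1; Kenku 1982) and the
  integrality of rational multipliers `q Λ_f ⊆ Λ_{E'} ⇒ q ∈ ℤ` for globally minimal parametrised
  `E'` (Edixhoven 1991, Prop. 2; spelled out, not a named fact of the tree).

Trust base of the item after this file: `exists_isNewformOf` (semistable case) and
`PastenShimura2024_minimalDegree_le_163_mul` (equivalently Mazur–Kenku + Néron integrality).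
Semistability is used only to weaken the modularity input to Wiles' case.

Maintenance record (full-build repair, 2026-08-16). Route rev 18 (2026-08-16T14:44:06Z, right-size
to the D-0019 caps) dropped the Theses decl `DegreePrimeCongruence` (stmt-ABC-14828, closed) from
the gate-written `Summits/ABC/ABC/Theses/IsogenyGlueCongruence.lean`, while this append-only file
and two files importing it (`…DegreePrimeCongruenceOfMazurKenku.lean`,
`…SemistableModularDatum.lean`) still name it ("Unknown identifier" in the full build of
2026-08-16T23:32Z). As announced in the sibling repair of
`…DegreePrimesOfCongruenceBound.lean` (which wrote the same text out verbatim inside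
`DegreePrimesOfCongruenceBound` precisely so that the name stays free), the dropped constant is
re-declared HERE — the most upstream of the three files naming it — under its original
fully-qualified name, with the ledger signature of stmt-ABC-14828 verbatim as definiens (NOT a route
item: no `route_item` attribute). The theorems of this file, their names, statement texts and
proof scripts are unchanged.

## References

* H. Pasten, *Shimura curves and the abc conjecture*, J. Number Theory 254 (2024), 214–335:
  §3 p. 13, Thm. 5.5 p. 18. [PastenShimura2024]
* B. Mazur, *Rational isogenies of prime degree*, Invent. Math. 44 (1978): Thm. 1. [Mazur1978]
* M. A. Kenku, J. Number Theory 15 (1982), 199–202. [Kenku1982]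
* B. Edixhoven, *On the Manin constants of modular elliptic curves* (1991): Prop. 2.
  [EdixhovenManin1991]
* A. Wiles, Ann. of Math. 141 (1995): Thm. 0.4; C. Breuil, B. Conrad, F. Diamond, R. Taylor,
  J. Amer. Math. Soc. 14 (2001): Thm. A. [BCDTJAMS2001]
-/

-- `Summit.ABC.ABC` is the mandated summit-side namespace (CONVENTIONS §2); the duplicate is
-- deliberate.
set_option linter.dupNamespace false

noncomputable section

open scoped MatrixGroups ModularForm

open CongruenceSubgroup
open Literature.NumberTheory.EllipticCurves
open Literature.NumberTheory.EllipticCurves.ModularForms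
open Literature.NumberTheory.Automorphic

/-! ### Record of the dropped route decl `DegreePrimeCongruence` (stmt-ABC-14828) -/

namespace Summit.ABC.ABC.Theses.IsogenyGlueCongruence

/-- **Record of the dropped route item `DegreePrimeCongruence`** = stmt-ABC-14828 (support item of
the `K`-line of route `IsogenyGlueCongruence`, closed; dropped from the route file at rev 18,
2026-08-16T14:44:06Z; NOT a route item): re-declared under its original fully-qualified name, with
the item's ledger signature verbatim as definiens, solely so that this append-only file and the two
Theorems files importing it keep elaborating. Content: every semistable elliptic `W/ℚ` given by a
globally minimal model, of conductor `N = W.conductorNorm ℤ`, has a modular parametrisation datum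
`D` at level `N` such that every prime `ℓ ∣ deg D` is `≤ 163` or a congruence prime of `f_W` with a
newform `g` of some level `M ∣ N` (`IsNewform0 g ∧ ¬ IsNewformOf W g`), witnessed by a subring
`R ⊆ ℂ` containing all `aₙ(g)`, a field `F` of characteristic `ℓ` and a ring map `φ : R →+* F` with
`φ (a_p g) = a_p W` for all primes `p ∤ M·N·ℓ` (Pasten 2024, §3 p. 13 with Thm. 5.5 p. 18, modulo
modularity and the Mazur–Kenku comparison; see `degreePrimeCongruence_of_modularity` below). A
route statement, not a result in print under this name: deliberately carries no cite tag (it is not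
to be relocated to `Literature/`). -/
def DegreePrimeCongruence : Prop :=
  ∀ (W : WeierstrassCurve ℚ) [W.IsElliptic] [W.IsGloballyMinimal] [NeZero (W.conductorNorm ℤ)],
    W.IsSemistable ℤ →
      ∃ D : Literature.NumberTheory.EllipticCurves.ModularForms.ModularParametrizationData W
          (W.conductorNorm ℤ),
        ∀ ℓ : ℕ, ℓ.Prime → ℓ ∣ D.modularDegree → ℓ ≤ 163 ∨
          ∃ (M : ℕ) (_ : NeZero M) (g : CuspForm (CongruenceSubgroup.Gamma0 M) 2),
            M ∣ W.conductorNorm ℤ ∧ Literature.NumberTheory.EllipticCurves.ModularForms.IsNewform0 g ∧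
              ¬ Literature.NumberTheory.EllipticCurves.ModularForms.IsNewformOf W g ∧
              ∃ (R : Subring ℂ) (F : Type) (_ : Field F) (_ : CharP F ℓ) (φ : R →+* F)
                (hg : ∀ n : ℕ, Literature.NumberTheory.EllipticCurves.ModularForms.cuspCoeff g n ∈ R),
                ∀ p : ℕ, p.Prime → ¬ (p ∣ M * W.conductorNorm ℤ * ℓ) →
                  φ ⟨Literature.NumberTheory.EllipticCurves.ModularForms.cuspCoeff g p, hg p⟩ =
                    ((W.LFunction p : ℤ) : F)

end Summit.ABC.ABC.Theses.IsogenyGlueCongruence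

namespace Summit.ABC.ABC.Theorems

/-! ### Per curve: the conclusion of the item from any datum -/

/-- **The item per curve, from any datum.** Let `W/ℚ` be a globally minimal elliptic curve with a
parametrisation datum at level `N`. Then `W` has a datum `D'` at level `N` such that every prime
`ℓ ∣ deg D'` is `≤ 163` or a congruence prime of the newform of `W` with another newform `g` of some
level `M ∣ N` (`IsNewform0 g ∧ ¬ IsNewformOf W g`), realised by a ring map `φ : R → F` from a subring
`R ⊆ ℂ` containing all `aₙ(g)` to a field of characteristic `ℓ` with `φ(a_p(g)) = a_p(W)` for all
primes `p ∤ M N ℓ`. Proof: the datum branch `datumBranch_of_le_163_mul` (Mazur–Kenku comparison,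
hypothesis `h163`) gives `D'` and an optimal `D₀` of a curve `W₀` with the same newform such that
every prime of `deg D'` is `≤ 163` or divides `deg D₀ = δ_{1,N}`; the congruence branch
`congruenceBranch_of_thm_5_5`, now fed with the THEOREM `PastenShimura2024_thm_5_5_holds`, turns the
latter into the congruence; `aₙ(W₀) = aₙ(f) = aₙ(W)` transfers it from `W₀` to `W`.
[cite: PastenShimura2024, Thm. 5.5 p. 18 and §3 p. 13] -/
theorem degreePrimeCongruence_of_datum (h163 : PastenShimura2024_minimalDegree_le_163_mul)
    {W : WeierstrassCurve ℚ} [W.IsElliptic] [W.IsGloballyMinimal] {N : ℕ} [NeZero N]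
    (D : ModularParametrizationData W N) :
    ∃ D' : ModularParametrizationData W N, ∀ ℓ : ℕ, ℓ.Prime → ℓ ∣ D'.modularDegree → ℓ ≤ 163 ∨
      ∃ (M : ℕ) (_ : NeZero M) (g : CuspForm (Gamma0 M) 2), M ∣ N ∧ IsNewform0 g ∧
        ¬ IsNewformOf W g ∧
        ∃ (R : Subring ℂ) (F : Type) (_ : Field F) (_ : CharP F ℓ) (φ : R →+* F)
          (hg : ∀ n : ℕ, cuspCoeff g n ∈ R),
          ∀ p : ℕ, p.Prime → ¬ (p ∣ M * N * ℓ) →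
            φ ⟨cuspCoeff g p, hg p⟩ = ((W.LFunction p : ℤ) : F) := by
  obtain ⟨D', W₀, hW₀, D₀, hf₀, hmin, hprimes⟩ := datumBranch_of_le_163_mul h163 D
  haveI := hW₀
  refine ⟨D', fun ℓ hℓ hℓd ↦ ?_⟩
  rcases hprimes ℓ hℓ hℓd with h163' | hℓ₀
  · exact Or.inl h163'
  right
  obtain ⟨M, hM, g, hMN, hg, hng, R, F, hF, hchar, φ, hgR, hcong⟩ :=
    congruenceBranch_of_thm_5_5 PastenShimura2024_thm_5_5_holds D₀ hmin hℓ hℓ₀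
  -- `W₀` and `W` have the same `aₙ`, both being the coefficients of `D₀.f = D'.f`
  have hLF : ∀ n : ℕ, W₀.LFunction n = W.LFunction n := fun n ↦ by
    have h₀ := D₀.isNewformOf.2 n
    have h' := D'.isNewformOf.2 n
    rw [hf₀] at h₀
    exact_mod_cast h₀.symm.trans h'
  refine ⟨M, hM, g, hMN, hg, fun hWg ↦ hng ⟨hWg.1, fun n ↦ ?_⟩, R, F, hF, hchar, φ, hgR,
    fun p hp hpd ↦ ?_⟩
  · rw [hWg.2 n, hLF n]
  · rw [hcong p hp hpd, hLF p]

/-! ### The item is semistable modularity, given the Mazur–Kenku comparison -/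

/-- **Given the Mazur–Kenku comparison, `DegreePrimeCongruence` is EQUIVALENT to the modularity of
semistable elliptic curves over `ℚ`** — `BCDT.IsModular W` ("a newform of `W` exists in
`S₂(Γ₀(N_W))`") for every semistable elliptic `W/ℚ` given by a globally minimal model (Wiles 1995,
Thm. 0.4, with Taylor–Wiles; for all curves BCDT 2001, Thm. A = `exists_isNewformOf`, see
`BCDT.exists_isNewformOf_iff`). (→) the datum provided by the item carries the newform of `W`;
(←) given the newform `f`, a Néron-type period pair `L` of `W/ℂ` (`exists_isNeronLatticeOf_holds`)
and an integer `c ≠ 0` with `c Λ_f ⊆ Λ_L` (`IsNewformOf.exists_maninConstant_ne_zero_holds`,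
Shimura's construction and Faltings) give a datum (`nonempty_modularParametrizationData_of_isNewformOf`),
and `degreePrimeCongruence_of_datum` does the rest. So the exact content of the item beyond the
comparison is Wiles' theorem. [cite: PastenShimura2024, §3 p. 13] -/
theorem degreePrimeCongruence_iff_semistableModularity
    (h163 : PastenShimura2024_minimalDegree_le_163_mul) :
    Summit.ABC.ABC.Theses.IsogenyGlueCongruence.DegreePrimeCongruence ↔
      ∀ (W : WeierstrassCurve ℚ) [W.IsElliptic] [W.IsGloballyMinimal]
        [NeZero (W.conductorNorm ℤ)], W.IsSemistable ℤ → BCDT.IsModular W := by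
  refine ⟨fun h W _ _ _ hW ↦ ?_, fun hmod W _ _ _ hW ↦ ?_⟩
  · obtain ⟨D, -⟩ := h W hW
    exact ⟨D.f, D.isNewformOf⟩
  · obtain ⟨f, hf⟩ := hmod W hW
    haveI : (W.baseChange ℂ).IsElliptic := by rw [WeierstrassCurve.baseChange]; infer_instance
    obtain ⟨L, hL⟩ := exists_isNeronLatticeOf_holds (W.baseChange ℂ)
    obtain ⟨c, hc0, hc⟩ := IsNewformOf.exists_maninConstant_ne_zero_holds hf hL
    obtain ⟨D⟩ := nonempty_modularParametrizationData_of_isNewformOf hf hL hc0 hc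
    exact degreePrimeCongruence_of_datum h163 D

/-! ### The route decl from named facts -/

/-- **`DegreePrimeCongruence` (route `IsogenyGlueCongruence`, item stmt-ABC-14828) from two named
facts**: modularity (`exists_isNewformOf`, BCDT 2001 Thm. A; only its semistable case, Wiles 1995,
is used) and the Mazur–Kenku comparison `PastenShimura2024_minimalDegree_le_163_mul` (Pasten 2024,
§3 p. 13: a minimal isogeny from the optimal curve has degree `≤ 163`), by
`degreePrimeCongruence_iff_semistableModularity`. Pasten's Thm. 5.5 is no longer a hypothesis
(`PastenShimura2024_thm_5_5_holds`). This is the closed form of the item modulo named facts: it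
closes as `degreePrimeCongruence_of_modularity exists_isNewformOf_holds …_holds` the day both facts
are discharged. [cite: PastenShimura2024, §3 p. 13 and Thm. 5.5 p. 18] -/
theorem degreePrimeCongruence_of_modularity (hmod : exists_isNewformOf)
    (h163 : PastenShimura2024_minimalDegree_le_163_mul) :
    Summit.ABC.ABC.Theses.IsogenyGlueCongruence.DegreePrimeCongruence :=
  (degreePrimeCongruence_iff_semistableModularity h163).mpr fun W _ _ _ _ ↦
    BCDT.exists_isNewformOf_iff.mp hmod W

/-- **`DegreePrimeCongruence` from modularity, Mazur–Kenku and Néron integrality**: the variant of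
`degreePrimeCongruence_of_modularity` with the comparison fact replaced by its two printed
ingredients through the tree's `PastenShimura2024_minimalDegree_le_163_mul_of_mazurKenku` — the
named fact `mazurKenku_exists_cyclic_isogeny` (`ℚ`-isogenous elliptic curves are joined by a cyclic
`ℚ`-isogeny of degree in `{1,…,19,21,25,27,37,43,67,163}`; Mazur 1978 Thm. 1, Kenku 1982) and the
integrality `hInt` of rational multipliers into the Néron lattice of a globally minimal parametrised
curve (`q Λ_f ⊆ Λ_{E'} ⇒ q ∈ ℤ`: the Néron mapping property on the smooth locus of `X₀(N)_ℤ` and the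
`q`-expansion principle; Edixhoven 1991, Prop. 2, whose argument does not use optimality), which is
not a statement of the tree and stays a hypothesis. [cite: Mazur1978, Thm. 1] [cite: Kenku1982]
[cite: EdixhovenManin1991, Prop. 2] -/
theorem degreePrimeCongruence_of_mazurKenku (hmod : exists_isNewformOf)
    (hMK : mazurKenku_exists_cyclic_isogeny)
    (hInt : ∀ {N : ℕ} [NeZero N] {W' : WeierstrassCurve ℚ} [W'.IsElliptic] [W'.IsGloballyMinimal]
      (D' : ModularParametrizationData W' N) (q : ℚ),
      (∀ z ∈ periodLattice D'.f, (q : ℂ) * z ∈ D'.L.lattice) → ∃ k : ℤ, (k : ℚ) = q) :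
    Summit.ABC.ABC.Theses.IsogenyGlueCongruence.DegreePrimeCongruence :=
  degreePrimeCongruence_of_modularity hmod
    (PastenShimura2024_minimalDegree_le_163_mul_of_mazurKenku hMK hInt)

end Summit.ABC.ABC.Theorems

end
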